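import Summits.QuantumFields.YangMills.Theorems.BalabanUVNodesN15TwoSpacingGluingCurvedKnitSmallFieldCovariantGradient
import Summits.QuantumFields.YangMills.Theorems.BalabanUVNodesN15TwoSpacingGluingCurvedKnitSmallFieldNodeTwo
import HarnessLib

/-!
# THE GLUING STEP AT TWO LATTICE SPACINGS — (∇0) `T4EtaRate.NE2PlusOperator` BY NAME FOR THE LIVE-BACKGROUND GLUED FAMILY WITH ALL FOUR ENTRIES OF (3.42) CONSTRUCTED, THE GRADIENT
# ENTRIES = THE COVARIANT FORWARD GRADIENTS `D^η_{R⁺_μ}𝒢` (FILE 144): entry 0 (130), entries 1–2 (144, directions `μ₁, μ₂`), entry 3 (134) (dag-n15-c g17, FILE 145; N15 = NE2, s1)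

Cell `pub-ymgap`, seat `pub-ymgap-dag-n15-c` (R134 (a); HUMAN RULING D-0062), generation 17.  `bears_on: R4∕N15 · K3⁸ SpineGivenEndpointR13SepCoPHV (stmt-QuantumFields-27366)`.
Filed `--kind proof --supports stmt-QuantumFields-27366 --as helper` — COUNT-NEUTRAL.  Theorems only; 0 `def`, 0 `sorry`.  Imports BY NAME FILE 144 `…CurvedKnitSmallFieldCovariantGradient`
(`sf_idef_covD_cvGlued`) and FILE 135 `…CurvedKnitSmallFieldNodeTwo` (`ne2PlusOperator_sf₃`; through it 132, 131, 134, 130).  FILE 140's text with the flat jets replaced by the covariant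
forward gradients; nothing in the tree is modified.

WHAT.  ★★★ `ne2PlusOperator_sf₄_cov` — for directions `μ₁, μ₂`, if the consumer's `E i 1`, `E i 2` are the η-defects of the COVARIANT forward gradients `D^{η′}_{R′⁺_{μ₁}}𝒢′` vs
`D^η_{R⁺_{μ₁}}𝒢` and `… μ₂ …` of the live glued pair (n15-b `covD`: Bałaban's (3.50) covariant difference with the exact coefficients (3.51)–(3.52)) and `E i 3` is the Laplacian η-defect
(three pinning equations), then `NE2PlusOperator c₃₅ (sfInstance d mm ι hL) (fun i => sfFamily d mm ι a e hL i (E i))` — ALL FOUR ENTRIES CONSTRUCTED AND PROVED, the gradient entries being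
(3.42)'s `∇_UG(U)` in two chosen directions, `M = L^m` LIVE, hypotheses = `L ≥ 7` odd, `a, c₃₅ > 0`, trace-form-orthonormal `e` only.

HONEST FRAMING ∕ LIMITS.  Bookkeeping over LANDED theorems; MODEL family (global small-field gauge = (3.35) with `u ≡ 1`; covariant Laplacian (3.50) ⊗ colour + FLAT nonlocal part (1.69) —
NOT Bałaban's `Δ_a(U)` (3.26); the right-composed entry `𝒢∇*_U` of (3.42) is NOT here — two forward covariant gradients fill entries 1–2; C² window incl. all mixed second differences;
King-block-mean pairing; doubled-torus cover); the η-RATE inequality is NOT PRINTED ([B9] Thm 3.14 = domain differences); nothing of [B5]∕[B6]∕[B9] asserted.  NE2⁺ for THIS model family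
only — NOT the record's K3⁸ socket; N15 NOT discharged; K3⁸ OPEN, skeleton v6 untouched (0∕2); counts of record UNMOVED (typed 28∕28 · discharged 5∕27 · A 5∕28); one finite 𝕋⁴ at fixed
ε — NOT infinite volume, NOT OS on ℝ⁴, NOT a mass gap, NOT Clay; R4 closes the conditional finite-𝕋⁴ rung `BalabanLadder.UV` only.  Restate-immune (no Theses import).
-/

noncomputable section

open scoped BigOperators Matrix Matrix.Norms.Frobenius

namespace Summit.QuantumFields.YangMills.BalabanUVNodes.N15.Gluing

open Literature.MathematicalPhysics.QuantumFieldTheory.Balaban1983to89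
open Literature.MathematicalPhysics.QuantumFieldTheory.Balaban1983to89.B11SectG (BlockNorm HasMaj)
open Literature.MathematicalPhysics.QuantumFieldTheory.Balaban1983to89.T4EtaRate (NE2PlusOperator rateFactor)
open Literature.MathematicalPhysics.QuantumFieldTheory.Balaban1983to89.T4EtaRateDefect (idef)
open Literature.MathematicalPhysics.QuantumFieldTheory.Balaban1983to89.T4EtaRateCoeffDefect (pull)
open Literature.MathematicalPhysics.QuantumFieldTheory.Balaban1983to89.B6UnitTorusCarrier (unitTorusGeo)
open Literature.Barriers.QuantumFields (traceForm)
open Summit.QuantumFields.YangMills.BalabanUVNodes.N15.BackgroundLayer (covLapM gavgM fgrad bgrad)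
open Summit.QuantumFields.YangMills.BalabanUVNodes.N15.VectorPiece (bshiftEquiv kingPrV)
open Summit.QuantumFields.YangMills.BalabanUVNodes.N15.MatrixSpecies (coordMat liftBlk liftMap liftEquiv basisConst basisConst_nonneg covD)
open Summit.QuantumFields.YangMills.BalabanUVNodes.N15.OperatorReadout (opGeo opGeo_len pref4_pos)
open Summit.QuantumFields.YangMills.BalabanUVNodes.N15.CurvedSpecies (gaugePair)

variable (d : ℕ) {L : ℕ} [NeZero L] (mm ι : Type) [Fintype mm] [DecidableEq mm] [Fintype ι] [DecidableEq ι] (e : Matrix mm mm ℂ ≃L[ℝ] (ι → ℝ))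

set_option maxHeartbeats 800000 in
/-- ★★★ **NE2⁺, OPERATOR LAYER, BY NAME, FOR THE LIVE-BACKGROUND GLUED FAMILY — ALL FOUR ENTRIES OF (3.42) CONSTRUCTED, THE GRADIENT ENTRIES COVARIANT.**  For odd `L ≥ 7`, `a > 0`,
`c₃₅ > 0`, trace-form-orthonormal `e`, directions `μ₁, μ₂`: if the consumer's `E i 1`, `E i 2` are the η-defects of the covariant forward gradients `D^η_{R⁺_{μ₁}}𝒢`, `D^η_{R⁺_{μ₂}}𝒢` of the
live glued pair and `E i 3` the η-defect `𝔇_π̂(Δ′_{U′}G′, Δ_UG)` (three pinning equations), then `NE2PlusOperator c₃₅ (sfInstance d mm ι hL) (fun i => sfFamily d mm ι a e hL i (E i))` — entry 0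
(FILE 130), entries 1–2 (FILE 144), entry 3 (FILE 134), NO displayed majorant hypothesis.  MODEL family; NOT [B9] Thm 3.1∕3.14 as printed.
[cite: Balaban1985BackgroundPropagators, Thm 3.1 p.397 (quantifier template, (3.42): the four entries, `∇_UG`), (3.50)–(3.52) p.400, Thm 3.14 pp.426–427 (difference template), (3.35)–(3.36) p.396; King1986, Prop. 3.9 (3.73) p.665 (rate factor); Balaban1984PropagatorsII, (2.91)–(2.93) p.239] -/
theorem ne2PlusOperator_sf₄_cov (hL : Odd L ∧ 1 < L) (hL7 : 7 ≤ L) {a : ℝ} (ha : 0 < a) {c35 : ℝ} (hc35 : 0 < c35) (he : ∀ A B : Matrix mm mm ℂ, traceForm A B = e A ⬝ᵥ e B)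
    (μ₁ μ₂ : Fin (d + 1))
    (E : ∀ i : SfIdx d L, Fin 4 → (Fin (d + 1) → CvX' d L i.m i.kk i.r hL → Matrix mm mm ℂ) → ((CvX d L i.m i.kk hL × ι → ℝ) →ₗ[ℝ] (CvX' d L i.m i.kk i.r hL × ι → ℝ)))
    (hE1 : ∀ (i : SfIdx d L) (A' : Fin (d + 1) → CvX' d L i.m i.kk i.r hL → Matrix mm mm ℂ), E i 1 A' =
      idef (pull (liftMap (kingPrV L i.kk i.r (cvM d L i.m i.kk hL)) ι)) (pull (liftMap (kingPrV L i.kk i.r (cvM d L i.m i.kk hL)) ι))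
        (covD ((((L ^ i.r * L ^ i.kk : ℕ) : ℝ))⁻¹) (gaugePair (bshiftEquiv (cvM d L i.m i.kk hL) (L ^ i.r * L ^ i.kk)) (fun μ x' => coordMat e (ContinuousLinearMap.mulLeftRight ℝ (Matrix mm mm ℂ) (NormedSpace.exp (((((L ^ i.r * L ^ i.kk : ℕ) : ℝ))⁻¹) • A' μ x')) (NormedSpace.exp (((((L ^ i.r * L ^ i.kk : ℕ) : ℝ))⁻¹) • A' μ x'))ᴴ)) (Sum.inl μ₁)) (bshiftEquiv (cvM d L i.m i.kk hL) (L ^ i.r * L ^ i.kk) μ₁) ∘ₗ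
          cvGlued' d L i.m i.kk i.r hL a ((((L ^ i.r * L ^ i.kk : ℕ) : ℝ))⁻¹) ι e (fun _ _ => (1 : Matrix mm mm ℂ)) (fun μ x' => NormedSpace.exp (((((L ^ i.r * L ^ i.kk : ℕ) : ℝ))⁻¹) • A' μ x')) (cvNL' d L i.m i.kk i.r hL a ι) (fun _ => 0))
        (covD ((((L ^ i.kk : ℕ) : ℝ))⁻¹) (gaugePair (bshiftEquiv (cvM d L i.m i.kk hL) (L ^ i.kk)) (fun μ x => coordMat e (ContinuousLinearMap.mulLeftRight ℝ (Matrix mm mm ℂ) (NormedSpace.exp (((((L ^ i.kk : ℕ) : ℝ))⁻¹) • gavgM (Matrix mm mm ℂ) (Fin (d + 1)) (kingPrV L i.kk i.r (cvM d L i.m i.kk hL)) A' μ x)) (NormedSpace.exp (((((L ^ i.kk : ℕ) : ℝ))⁻¹) • gavgM (Matrix mm mm ℂ) (Fin (d + 1)) (kingPrV L i.kk i.r (cvM d L i.m i.kk hL)) A' μ x))ᴴ)) (Sum.inl μ₁)) (bshiftEquiv (cvM d L i.m i.kk hL) (L ^ i.kk) μ₁) ∘ₗ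
          cvGlued d L i.m i.kk hL a ((((L ^ i.kk : ℕ) : ℝ))⁻¹) ι e (fun _ _ => (1 : Matrix mm mm ℂ)) (fun μ x => NormedSpace.exp (((((L ^ i.kk : ℕ) : ℝ))⁻¹) • gavgM (Matrix mm mm ℂ) (Fin (d + 1)) (kingPrV L i.kk i.r (cvM d L i.m i.kk hL)) A' μ x)) (cvNL d L i.m i.kk hL a ι) (fun _ => 0)))
    (hE2 : ∀ (i : SfIdx d L) (A' : Fin (d + 1) → CvX' d L i.m i.kk i.r hL → Matrix mm mm ℂ), E i 2 A' =
      idef (pull (liftMap (kingPrV L i.kk i.r (cvM d L i.m i.kk hL)) ι)) (pull (liftMap (kingPrV L i.kk i.r (cvM d L i.m i.kk hL)) ι))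
        (covD ((((L ^ i.r * L ^ i.kk : ℕ) : ℝ))⁻¹) (gaugePair (bshiftEquiv (cvM d L i.m i.kk hL) (L ^ i.r * L ^ i.kk)) (fun μ x' => coordMat e (ContinuousLinearMap.mulLeftRight ℝ (Matrix mm mm ℂ) (NormedSpace.exp (((((L ^ i.r * L ^ i.kk : ℕ) : ℝ))⁻¹) • A' μ x')) (NormedSpace.exp (((((L ^ i.r * L ^ i.kk : ℕ) : ℝ))⁻¹) • A' μ x'))ᴴ)) (Sum.inl μ₂)) (bshiftEquiv (cvM d L i.m i.kk hL) (L ^ i.r * L ^ i.kk) μ₂) ∘ₗ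
          cvGlued' d L i.m i.kk i.r hL a ((((L ^ i.r * L ^ i.kk : ℕ) : ℝ))⁻¹) ι e (fun _ _ => (1 : Matrix mm mm ℂ)) (fun μ x' => NormedSpace.exp (((((L ^ i.r * L ^ i.kk : ℕ) : ℝ))⁻¹) • A' μ x')) (cvNL' d L i.m i.kk i.r hL a ι) (fun _ => 0))
        (covD ((((L ^ i.kk : ℕ) : ℝ))⁻¹) (gaugePair (bshiftEquiv (cvM d L i.m i.kk hL) (L ^ i.kk)) (fun μ x => coordMat e (ContinuousLinearMap.mulLeftRight ℝ (Matrix mm mm ℂ) (NormedSpace.exp (((((L ^ i.kk : ℕ) : ℝ))⁻¹) • gavgM (Matrix mm mm ℂ) (Fin (d + 1)) (kingPrV L i.kk i.r (cvM d L i.m i.kk hL)) A' μ x)) (NormedSpace.exp (((((L ^ i.kk : ℕ) : ℝ))⁻¹) • gavgM (Matrix mm mm ℂ) (Fin (d + 1)) (kingPrV L i.kk i.r (cvM d L i.m i.kk hL)) A' μ x))ᴴ)) (Sum.inl μ₂)) (bshiftEquiv (cvM d L i.m i.kk hL) (L ^ i.kk) μ₂) ∘ₗ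
          cvGlued d L i.m i.kk hL a ((((L ^ i.kk : ℕ) : ℝ))⁻¹) ι e (fun _ _ => (1 : Matrix mm mm ℂ)) (fun μ x => NormedSpace.exp (((((L ^ i.kk : ℕ) : ℝ))⁻¹) • gavgM (Matrix mm mm ℂ) (Fin (d + 1)) (kingPrV L i.kk i.r (cvM d L i.m i.kk hL)) A' μ x)) (cvNL d L i.m i.kk hL a ι) (fun _ => 0)))
    (hE3 : ∀ (i : SfIdx d L) (A' : Fin (d + 1) → CvX' d L i.m i.kk i.r hL → Matrix mm mm ℂ), E i 3 A' =
      idef (pull (liftMap (kingPrV L i.kk i.r (cvM d L i.m i.kk hL)) ι)) (pull (liftMap (kingPrV L i.kk i.r (cvM d L i.m i.kk hL)) ι)) ((covLapM (bshiftEquiv (cvM d L i.m i.kk hL) (L ^ i.r * L ^ i.kk)) ((((L ^ i.r * L ^ i.kk : ℕ) : ℝ))⁻¹) (gaugePair (bshiftEquiv (cvM d L i.m i.kk hL) (L ^ i.r * L ^ i.kk)) (fun μ x' => coordMat e (ContinuousLinearMap.mulLeftRight ℝ (Matrix mm mm ℂ) (NormedSpace.exp (((((L ^ i.r * L ^ i.kk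 : ℕ) : ℝ))⁻¹) • A' μ x')) (NormedSpace.exp (((((L ^ i.r * L ^ i.kk : ℕ) : ℝ))⁻¹) • A' μ x'))ᴴ)))) ∘ₗ (cvGlued' d L i.m i.kk i.r hL a ((((L ^ i.r * L ^ i.kk : ℕ) : ℝ))⁻¹) ι e (fun _ _ => (1 : Matrix mm mm ℂ)) (fun μ x' => NormedSpace.exp (((((L ^ i.r * L ^ i.kk : ℕ) : ℝ))⁻¹) • A' μ x')) (cvNL' d L i.m i.kk i.r hL a ι) (fun _ => 0))) ((covLapM (bshiftEquiv (cvM d L i.m i.kk hL) (L ^ i.kk)) ((((L ^ i.kk : ℕ) : ℝ))⁻¹) (gaugePair (bshiftEquiv (cvM d L i.m i.kk hL) (L ^ i.kk)) (fun μ x => coordMat e (ContinuousLinearMap.mulLeftRight ℝ (Matrix mm mm ℂ) (NormedSpace.exp (((((L ^ i.kk : ℕ) : ℝ))⁻¹) • gavgM (Matrix mm mm ℂ) (Fin (d + 1)) (kingPrV L i.kk i.r (cvM d L i.m i.kk hL)) A' μ x)) (NormedSpace.exp (((((L ^ i.kk : ℕ) : ℝ))⁻¹) • gavgM (Matrix mm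 mm ℂ) (Fin (d + 1)) (kingPrV L i.kk i.r (cvM d L i.m i.kk hL)) A' μ x))ᴴ)))) ∘ₗ (cvGlued d L i.m i.kk hL a ((((L ^ i.kk : ℕ) : ℝ))⁻¹) ι e (fun _ _ => (1 : Matrix mm mm ℂ)) (fun μ x => NormedSpace.exp (((((L ^ i.kk : ℕ) : ℝ))⁻¹) • gavgM (Matrix mm mm ℂ) (Fin (d + 1)) (kingPrV L i.kk i.r (cvM d L i.m i.kk hL)) A' μ x)) (cvNL d L i.m i.kk hL a ι) (fun _ => 0)))) :
    NE2PlusOperator c35 (sfInstance d mm ι hL) (fun i => sfFamily d mm ι a e hL i (E i)) := by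
  obtain ⟨δ, w₀, R₀, D, hδ, hR₀, H⟩ := sf_idef_covD_cvGlued (d := d) hL hL7 ha ι
  have hLpos : 0 < L := Nat.pos_of_ne_zero (NeZero.ne L)
  have hLr : (0 : ℝ) < (L : ℝ) := Nat.cast_pos.mpr hLpos
  have hL1 : (1 : ℝ) ≤ (L : ℝ) := by exact_mod_cast hLpos
  -- the constants of the gradient entries (as 132's entry-0 constants)
  have hκ0 : 0 ≤ basisConst e := basisConst_nonneg e
  let σ : ℝ := 14 * Real.exp 1 * (1 + Fintype.card (Fin (d + 1))) * basisConst e * ((1 + Fintype.card (Fin (d + 1))) * (3 + 2 * ((d : ℝ) + 1)))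
  have hσ0 : 0 ≤ σ := by positivity
  let JJ : ℝ := 1 + Fintype.card (Fin (d + 1) ⊕ Fin (d + 1))
  have hJJ0 : 0 ≤ JJ := by positivity
  let W : ℝ := 2 * ((1 + Fintype.card (Fin (d + 1))) * (3 + 2 * ((d : ℝ) + 1)))
  have hW0 : 0 < W := by positivity
  let aW : ℝ := 1 / (W * c35)
  have haW : 0 < aW := by positivity
  let aR : ℝ := R₀ / (σ * c35 * JJ + 1)
  have haR : 0 < aR := by positivity
  let a₁ : ℝ := min aW aR
  have ha₁ : 0 < a₁ := lt_min haW haR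
  have ha₁W : a₁ ≤ aW := min_le_left _ _
  have ha₁R : a₁ ≤ aR := min_le_right _ _
  let M₁ : ℝ := max w₀ 1
  have hM₁ : 0 < M₁ := lt_of_lt_of_le one_pos (le_max_right _ _)
  let B₁ : ℝ := max D 0 * (1 + σ * (c35 * a₁) * JJ) + 1
  have hB₁ : 0 < B₁ := add_pos_of_nonneg_of_pos (by positivity) one_pos
  refine ne2PlusOperator_sf₃ d mm ι e hL hL7 ha hc35 he E hE3 ⟨M₁, δ, a₁, B₁, 1 / 16, hM₁, hδ, ha₁, hB₁, by norm_num, fun i hM α₀ hα₀ hMa A' hA' n hn0 hn3 => ?_⟩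
  -- the index's scalar facts
  have hw₀ : w₀ ≤ ((L ^ i.m : ℕ) : ℝ) := by push_cast; exact (le_max_left _ _).trans hM
  have hx1 : (1 : ℝ) ≤ (L : ℝ) ^ i.kk := one_le_pow₀ hL1
  have hxpos : (0 : ℝ) < (L : ℝ) ^ i.kk := pow_pos hLr _
  have hcast : (((L ^ i.kk : ℕ) : ℝ)) = (L : ℝ) ^ i.kk := by push_cast; rfl
  have hrf : ∀ y : (sfGeo d hL i).Site, ∀ γ' : ℝ, rateFactor (opGeo (sfGeo d hL i) (CvX d L i.m i.kk hL × ι) (liftBlk (cvBlk d L i.m i.kk hL) ι)) γ' y = ((L : ℝ) ^ i.kk) ^ (-γ') :=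
    fun y γ' => sfGeo_rateFactor d hL i _ γ' y
  have hinv : ((L : ℝ) ^ i.kk)⁻¹ ≤ ((L : ℝ) ^ i.kk) ^ (-(1 / 16 : ℝ)) := by
    rw [← Real.rpow_neg_one]
    exact Real.rpow_le_rpow_of_exponent_le hx1 (by norm_num)
  -- the class at the index: skewness and the C² window at scale `c₃₅L^mα₀`
  obtain ⟨hskew, h1, h2, h3⟩ := (sfInstance_reg335_iff d mm ι hL i c35 α₀ A').1 hA'
  have hconv : ((L : ℝ) ^ i.kk)⁻¹ * ((L : ℝ) ^ i.r)⁻¹ = (((L ^ i.r * L ^ i.kk : ℕ) : ℝ))⁻¹ := by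
    push_cast
    rw [mul_inv, mul_comm]
  have hrA0 : 0 ≤ c35 * (L : ℝ) ^ i.m * α₀ := by positivity
  have hrAa : c35 * (L : ℝ) ^ i.m * α₀ ≤ c35 * a₁ := by
    rw [mul_assoc]; exact mul_le_mul_of_nonneg_left hMa hc35.le
  have h2' : ∀ μ κ x', ‖A' μ (bshiftEquiv (cvM d L i.m i.kk hL) (L ^ i.r * L ^ i.kk) κ x') - A' μ x'‖ ≤ c35 * (L : ℝ) ^ i.m * α₀ * ((((L ^ i.r * L ^ i.kk : ℕ) : ℝ))⁻¹) :=
    fun μ κ x' => (h2 μ κ x').trans_eq (by rw [hconv])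
  have h3' : ∀ μ κ x', ‖(A' μ (bshiftEquiv (cvM d L i.m i.kk hL) (L ^ i.r * L ^ i.kk) κ x') - A' μ x') -
      (A' μ (bshiftEquiv (cvM d L i.m i.kk hL) (L ^ i.r * L ^ i.kk) κ ((bshiftEquiv (cvM d L i.m i.kk hL) (L ^ i.r * L ^ i.kk) μ).symm x')) -
        A' μ ((bshiftEquiv (cvM d L i.m i.kk hL) (L ^ i.r * L ^ i.kk) μ).symm x'))‖ ≤
      c35 * (L : ℝ) ^ i.m * α₀ * ((((L ^ i.r * L ^ i.kk : ℕ) : ℝ))⁻¹) * ((((L ^ i.r * L ^ i.kk : ℕ) : ℝ))⁻¹) :=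
    fun μ κ x' => (h3 μ κ x').trans_eq (by rw [hconv])
  have hr2 : 2 * ((1 + Fintype.card (Fin (d + 1))) * ((3 + 2 * ((d : ℝ) + 1)) * (c35 * (L : ℝ) ^ i.m * α₀))) ≤ 1 := by
    have hWa : W * (c35 * a₁) ≤ 1 := by
      calc W * (c35 * a₁) ≤ W * (c35 * aW) := mul_le_mul_of_nonneg_left (mul_le_mul_of_nonneg_left ha₁W hc35.le) hW0.le
        _ = 1 := by
          show W * (c35 * (1 / (W * c35))) = 1
          field_simp
    calc 2 * ((1 + Fintype.card (Fin (d + 1))) * ((3 + 2 * ((d : ℝ) + 1)) * (c35 * (L : ℝ) ^ i.m * α₀))) = W * (c35 * (L : ℝ) ^ i.m * α₀) := by ring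
      _ ≤ W * (c35 * a₁) := mul_le_mul_of_nonneg_left hrAa hW0.le
      _ ≤ 1 := hWa
  have hscale : 14 * Real.exp 1 * (1 + Fintype.card (Fin (d + 1))) * basisConst e * ((1 + Fintype.card (Fin (d + 1))) * ((3 + 2 * ((d : ℝ) + 1)) * (c35 * (L : ℝ) ^ i.m * α₀))) =
      σ * (c35 * (L : ℝ) ^ i.m * α₀) := by ring
  have hSle : σ * (c35 * (L : ℝ) ^ i.m * α₀) ≤ σ * (c35 * a₁) := mul_le_mul_of_nonneg_left hrAa hσ0
  have hRle : 14 * Real.exp 1 * (1 + Fintype.card (Fin (d + 1))) * basisConst e * ((1 + Fintype.card (Fin (d + 1))) * ((3 + 2 * ((d : ℝ) + 1)) * (c35 * (L : ℝ) ^ i.m * α₀))) *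
      (1 + Fintype.card (Fin (d + 1) ⊕ Fin (d + 1))) ≤ R₀ := by
    rw [hscale]
    have hRa : σ * (c35 * aR) * JJ ≤ R₀ := by
      have hden : 0 < σ * c35 * JJ + 1 := by positivity
      calc σ * (c35 * aR) * JJ = R₀ * (σ * c35 * JJ) / (σ * c35 * JJ + 1) := by
            show σ * (c35 * (R₀ / (σ * c35 * JJ + 1))) * JJ = R₀ * (σ * c35 * JJ) / (σ * c35 * JJ + 1)
            field_simp
        _ ≤ R₀ * (σ * c35 * JJ + 1) / (σ * c35 * JJ + 1) := by gcongr; linarith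
        _ = R₀ := by field_simp
    calc σ * (c35 * (L : ℝ) ^ i.m * α₀) * JJ ≤ σ * (c35 * a₁) * JJ := mul_le_mul_of_nonneg_right hSle hJJ0
      _ ≤ σ * (c35 * aR) * JJ := mul_le_mul_of_nonneg_right (mul_le_mul_of_nonneg_left (mul_le_mul_of_nonneg_left ha₁R hc35.le) hσ0) hJJ0
      _ ≤ R₀ := hRa
  -- the covariant gradient η-defect for EVERY direction, transferred to the sized carrier with the operator abstract (g16 lesson (e))
  have key : ∀ ν : Fin (d + 1), HasMaj (BlockNorm.ofBlocks (sfGeo d hL i) (liftBlk (cvBlk d L i.m i.kk hL) ι))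
      (BlockNorm.ofBlocks (sfGeo d hL i) (liftBlk (cvBlk d L i.m i.kk hL ∘ kingPrV L i.kk i.r (cvM d L i.m i.kk hL)) ι))
      (idef (pull (liftMap (kingPrV L i.kk i.r (cvM d L i.m i.kk hL)) ι)) (pull (liftMap (kingPrV L i.kk i.r (cvM d L i.m i.kk hL)) ι))
          (covD ((((L ^ i.r * L ^ i.kk : ℕ) : ℝ))⁻¹) (gaugePair (bshiftEquiv (cvM d L i.m i.kk hL) (L ^ i.r * L ^ i.kk)) (fun μ x' => coordMat e (ContinuousLinearMap.mulLeftRight ℝ (Matrix mm mm ℂ) (NormedSpace.exp (((((L ^ i.r * L ^ i.kk : ℕ) : ℝ))⁻¹) • A' μ x')) (NormedSpace.exp (((((L ^ i.r * L ^ i.kk : ℕ) : ℝ))⁻¹) • A' μ x'))ᴴ)) (Sum.inl ν)) (bshiftEquiv (cvM d L i.m i.kk hL) (L ^ i.r * L ^ i.kk) ν) ∘ₗ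
            cvGlued' d L i.m i.kk i.r hL a ((((L ^ i.r * L ^ i.kk : ℕ) : ℝ))⁻¹) ι e (fun _ _ => (1 : Matrix mm mm ℂ)) (fun μ x' => NormedSpace.exp (((((L ^ i.r * L ^ i.kk : ℕ) : ℝ))⁻¹) • A' μ x')) (cvNL' d L i.m i.kk i.r hL a ι) (fun _ => 0))
          (covD ((((L ^ i.kk : ℕ) : ℝ))⁻¹) (gaugePair (bshiftEquiv (cvM d L i.m i.kk hL) (L ^ i.kk)) (fun μ x => coordMat e (ContinuousLinearMap.mulLeftRight ℝ (Matrix mm mm ℂ) (NormedSpace.exp (((((L ^ i.kk : ℕ) : ℝ))⁻¹) • gavgM (Matrix mm mm ℂ) (Fin (d + 1)) (kingPrV L i.kk i.r (cvM d L i.m i.kk hL)) A' μ x)) (NormedSpace.exp (((((L ^ i.kk : ℕ) : ℝ))⁻¹) • gavgM (Matrix mm mm ℂ) (Fin (d + 1)) (kingPrV L i.kk i.r (cvM d L i.m i.kk hL)) A' μ x))ᴴ)) (Sum.inl ν)) (bshiftEquiv (cvM d L i.m i.kk hL) (L ^ i.kk) ν) ∘ₗ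
            cvGlued d L i.m i.kk hL a ((((L ^ i.kk : ℕ) : ℝ))⁻¹) ι e (fun _ _ => (1 : Matrix mm mm ℂ)) (fun μ x => NormedSpace.exp (((((L ^ i.kk : ℕ) : ℝ))⁻¹) • gavgM (Matrix mm mm ℂ) (Fin (d + 1)) (kingPrV L i.kk i.r (cvM d L i.m i.kk hL)) A' μ x)) (cvNL d L i.m i.kk hL a ι) (fun _ => 0)))
      (fun y y' => D * ((((L ^ i.kk : ℕ) : ℝ)) ^ (-(1 / 16 : ℝ)) + (14 * Real.exp 1 * (1 + Fintype.card (Fin (d + 1))) * basisConst e * ((1 + Fintype.card (Fin (d + 1))) * ((3 + 2 * ((d : ℝ) + 1)) * (c35 * (L : ℝ) ^ i.m * α₀)))) *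
        (1 + Fintype.card (Fin (d + 1) ⊕ Fin (d + 1))) * ((((L ^ i.kk : ℕ) : ℝ))⁻¹)) * Real.exp (-(δ * (unitTorusGeo L i.kk (cvM d L i.m i.kk hL)).dist y y'))) :=
    fun ν => hasMaj_unitTorusGeoS (d := d) (L := L) ((L : ℝ) ^ i.m) (H i.m i.kk i.r ν i.one_le hw₀ e he A' hskew (c35 * (L : ℝ) ^ i.m * α₀) hrA0 h1 h2' h3' hr2 hRle)
  -- which entry: `n ∈ {1, 2}` picks its direction and pinning equation
  have hEn : ∃ ν : Fin (d + 1), E i n A' =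
      idef (pull (liftMap (kingPrV L i.kk i.r (cvM d L i.m i.kk hL)) ι)) (pull (liftMap (kingPrV L i.kk i.r (cvM d L i.m i.kk hL)) ι))
          (covD ((((L ^ i.r * L ^ i.kk : ℕ) : ℝ))⁻¹) (gaugePair (bshiftEquiv (cvM d L i.m i.kk hL) (L ^ i.r * L ^ i.kk)) (fun μ x' => coordMat e (ContinuousLinearMap.mulLeftRight ℝ (Matrix mm mm ℂ) (NormedSpace.exp (((((L ^ i.r * L ^ i.kk : ℕ) : ℝ))⁻¹) • A' μ x')) (NormedSpace.exp (((((L ^ i.r * L ^ i.kk : ℕ) : ℝ))⁻¹) • A' μ x'))ᴴ)) (Sum.inl ν)) (bshiftEquiv (cvM d L i.m i.kk hL) (L ^ i.r * L ^ i.kk) ν) ∘ₗ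
            cvGlued' d L i.m i.kk i.r hL a ((((L ^ i.r * L ^ i.kk : ℕ) : ℝ))⁻¹) ι e (fun _ _ => (1 : Matrix mm mm ℂ)) (fun μ x' => NormedSpace.exp (((((L ^ i.r * L ^ i.kk : ℕ) : ℝ))⁻¹) • A' μ x')) (cvNL' d L i.m i.kk i.r hL a ι) (fun _ => 0))
          (covD ((((L ^ i.kk : ℕ) : ℝ))⁻¹) (gaugePair (bshiftEquiv (cvM d L i.m i.kk hL) (L ^ i.kk)) (fun μ x => coordMat e (ContinuousLinearMap.mulLeftRight ℝ (Matrix mm mm ℂ) (NormedSpace.exp (((((L ^ i.kk : ℕ) : ℝ))⁻¹) • gavgM (Matrix mm mm ℂ) (Fin (d + 1)) (kingPrV L i.kk i.r (cvM d L i.m i.kk hL)) A' μ x)) (NormedSpace.exp (((((L ^ i.kk : ℕ) : ℝ))⁻¹) • gavgM (Matrix mm mm ℂ) (Fin (d + 1)) (kingPrV L i.kk i.r (cvM d L i.m i.kk hL)) A' μ x))ᴴ)) (Sum.inl ν)) (bshiftEquiv (cvM d L i.m i.kk hL) (L ^ i.kk) ν) ∘ₗ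
            cvGlued d L i.m i.kk hL a ((((L ^ i.kk : ℕ) : ℝ))⁻¹) ι e (fun _ _ => (1 : Matrix mm mm ℂ)) (fun μ x => NormedSpace.exp (((((L ^ i.kk : ℕ) : ℝ))⁻¹) • gavgM (Matrix mm mm ℂ) (Fin (d + 1)) (kingPrV L i.kk i.r (cvM d L i.m i.kk hL)) A' μ x)) (cvNL d L i.m i.kk hL a ι) (fun _ => 0)) := by
    have hn : n = 1 ∨ n = 2 := by
      rcases n with ⟨n, hn⟩
      simp only [ne_eq, Fin.ext_iff, Fin.val_zero] at hn0 hn3 ⊢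
      simp only [show ((3 : Fin 4) : ℕ) = 3 from rfl] at hn3
      simp only [show ((1 : Fin 4) : ℕ) = 1 from rfl, show ((2 : Fin 4) : ℕ) = 2 from rfl]
      omega
    rcases hn with rfl | rfl
    · exact ⟨μ₁, hE1 i A'⟩
    · exact ⟨μ₂, hE2 i A'⟩
  obtain ⟨ν, hEν⟩ := hEn
  rw [hEν]
  refine (key ν).mono fun y y' => ?_
  -- the scalar comparison of the two kernels (as in 132's entry 0)
  rw [opGeo_len, sfGeo_len d hL i y, hrf y (1 / 16), hrf y' (1 / 16), max_self, hcast]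
  have hpref : B9.pref4 (1 : ℝ) n = 1 := by fin_cases n <;> simp [B9.pref4]
  rw [hpref, mul_one]
  have hd0 : 0 ≤ (sfGeo d hL i).dist y y' := sfGeo_dist_nonneg d hL i y y'
  have hE0 : 0 ≤ Real.exp (-(δ * (unitTorusGeo L i.kk (cvM d L i.m i.kk hL)).dist y y')) := Real.exp_nonneg _
  have hbr : ((L : ℝ) ^ i.kk) ^ (-(1 / 16 : ℝ)) + σ * (c35 * (L : ℝ) ^ i.m * α₀) * (1 + Fintype.card (Fin (d + 1) ⊕ Fin (d + 1))) * ((L : ℝ) ^ i.kk)⁻¹ ≤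
      (1 + σ * (c35 * a₁) * JJ) * ((L : ℝ) ^ i.kk) ^ (-(1 / 16 : ℝ)) := by
    have hB : σ * (c35 * (L : ℝ) ^ i.m * α₀) * (1 + Fintype.card (Fin (d + 1) ⊕ Fin (d + 1))) * ((L : ℝ) ^ i.kk)⁻¹ ≤ σ * (c35 * a₁) * JJ * ((L : ℝ) ^ i.kk) ^ (-(1 / 16 : ℝ)) :=
      mul_le_mul (mul_le_mul_of_nonneg_right hSle hJJ0) hinv (by positivity) (by positivity)
    nlinarith only [hB]
  have hrpos : 0 ≤ ((L : ℝ) ^ i.kk) ^ (-(1 / 16 : ℝ)) := Real.rpow_nonneg hxpos.le _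
  calc D * (((L : ℝ) ^ i.kk) ^ (-(1 / 16 : ℝ)) + 14 * Real.exp 1 * (1 + Fintype.card (Fin (d + 1))) * basisConst e * ((1 + Fintype.card (Fin (d + 1))) *
          ((3 + 2 * ((d : ℝ) + 1)) * (c35 * (L : ℝ) ^ i.m * α₀))) * (1 + Fintype.card (Fin (d + 1) ⊕ Fin (d + 1))) * ((L : ℝ) ^ i.kk)⁻¹) *
        Real.exp (-(δ * (unitTorusGeo L i.kk (cvM d L i.m i.kk hL)).dist y y'))
      ≤ max D 0 * ((1 + σ * (c35 * a₁) * JJ) * ((L : ℝ) ^ i.kk) ^ (-(1 / 16 : ℝ))) * Real.exp (-(δ * (unitTorusGeo L i.kk (cvM d L i.m i.kk hL)).dist y y')) := by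
        rw [hscale]
        refine mul_le_mul_of_nonneg_right ?_ hE0
        have hsum0 : 0 ≤ ((L : ℝ) ^ i.kk) ^ (-(1 / 16 : ℝ)) + σ * (c35 * (L : ℝ) ^ i.m * α₀) * (1 + Fintype.card (Fin (d + 1) ⊕ Fin (d + 1))) * ((L : ℝ) ^ i.kk)⁻¹ := by positivity
        exact (mul_le_mul_of_nonneg_right (le_max_left D 0) hsum0).trans (mul_le_mul_of_nonneg_left hbr (le_max_right _ _))
    _ = (max D 0 * (1 + σ * (c35 * a₁) * JJ)) * Real.exp (-(δ * (sfGeo d hL i).dist y y')) * ((L : ℝ) ^ i.kk) ^ (-(1 / 16 : ℝ)) := by ring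
    _ ≤ B₁ * Real.exp (-(δ * (sfGeo d hL i).dist y y')) * ((L : ℝ) ^ i.kk) ^ (-(1 / 16 : ℝ)) := by
        refine mul_le_mul_of_nonneg_right (mul_le_mul_of_nonneg_right ?_ (Real.exp_nonneg _)) hrpos
        show max D 0 * (1 + σ * (c35 * a₁) * JJ) ≤ max D 0 * (1 + σ * (c35 * a₁) * JJ) + 1
        linarith

end Summit.QuantumFields.YangMills.BalabanUVNodes.N15.Gluing

end
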